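import Mathlib
import Summits.KontsevichZagierPeriods.Zeta5Search.BigPrimePoles
import Summits.KontsevichZagierPeriods.Zeta5Search.DualSeriesNineCoefficients
import HarnessLib

/-!
# `F̃₉(b)` — the partial-fraction coefficients of `R_b` as Taylor coefficients at the poles (integer numerators;
# the `ℚ`/`ℤ` half of the `k = 9` big-prime divisibility theorem)

Cell `pub-zeta5` (HONEST FRAMING: systematic search; no irrationality claim unless certified).  Provenance: written
by the family-designer seat `pub-zeta5-fam-vwp-g13` (planner role, no stage permission; staged for the cell's lane),
`families/vwp/FAMILY.md` §21.  This file is the `k = 9` PORT of the typer's `Zeta5Search/BigPrimePoles.lean` (`k = 7`),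
for Zudilin's / Brown–Zudilin's dual very-well-poised series `F̃₉(b) = coeff7·ζ(7) + coeff5·ζ(5) + coeff3·ζ(3) − coeff0`
(`DualSeriesNine.vwp9_decomposition`; canonical coefficients through the partial-fraction data `IsPFData9` of
`R_b(t) = numPoly_b(t+1)/(t+1)_{b₀+1}^8`, `DualSeriesNineCoefficients.lean`).  The generic algebra (`truncInv`,
`taylor_prod'`, `map_taylor`, `taylor_X_add_C`, `block`, `pochPoly_pair_eq_prod_compl`) is imported from the `k = 7`
file, not re-proved.  Nothing here is a cited fact and nothing concerns irrationality: identities of rational numbers and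
integer polynomials.  The `𝔽_p` half and the theorems are in `Zeta5Search/BigPrimeNineDivisibility.lean`.

In the coordinate `y = t + 1` the summand is `R_b = numPoly_b(y) / ∏_{s=0}^{n} (y+s)^8` (`n = b₀`, `DualSeriesNine.term_eq`),
with poles at `y = −s`; `IsPFData9 b c` says that `c_{o,q}` (`o < 8`) is the coefficient of `(y+q)^{−(o+1)}`.  Contents
(word for word the `k = 7` file with `7 ↦ 9` lower parameters and pole order `6 ↦ 8`):
* `numR R n β = (2X + n) ∏_{j<9} ∏_{s ∈ [0,n]∖block_j} (X + s)` over any ring (`numPoly_eq_numR`: over `ℚ` it IS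
  `DualSeriesNine.numPoly b` when `2b_j ≤ b₀ + 1`), `ER R n q₀ = ∏_{s≠q₀}(X + s − q₀)^8`, `e0Z n q₀ = ∏_{s≠q₀} (s−q₀)^8`
  (`≠ 0`, no prime `p > n` divides it), `zZ n β q₀ i = [X^i] (numR(X − q₀) · truncInv E_{q₀} 8) ∈ ℤ`.
* `pf_coeff_eq`: `e₀(q₀)^8 · c_{o,q₀} = zZ n β q₀ (7−o)` for every pole `q₀ ≤ n` and order `o < 8`
  (route: `IsPFData9` ⇒ `Lpoly = numPoly` ⇒ `X^8 ∣ numPoly(X−q₀) − (Σ_o c_{o,q₀} X^{7−o})·E_{q₀}` ⇒ multiply by `truncInv`).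
-/

noncomputable section

open Finset Polynomial

namespace Summit.KontsevichZagierPeriods.Zeta5Search.BigPrimeNine

open Summit.KontsevichZagierPeriods.Zeta5Search.DualSeriesNine (InBox numPoly IsPFData9)
open Summit.KontsevichZagierPeriods.Zeta5Search.BigPrime (truncInv truncInv_spec truncInv_map
  coeff_eq_of_X_pow_dvd_sub taylor_prod' taylor_X_add_C block pochPoly_pair_eq_prod_compl)
open Literature.NumberTheory.Transcendental.BallRivoal (pochPoly pfEval poch)

/-! ### The integer-polynomial model of the numerator and of the pole data (`k = 9`, pole order `8`) -/

section Model

variable (R : Type*) [CommRing R]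

/-- The numerator `DualSeriesNine.numPoly b` in BLOCK form over any commutative ring (through ℕ-casts):
`(2X + n) · ∏_{j<9} ∏_{s ∈ [0,n] ∖ block_j} (X + s)`. -/
def numR (n : ℕ) (β : ℕ → ℕ) : R[X] :=
  (C 2 * X + C (n : R)) * ∏ j ∈ range 9, ∏ s ∈ range (n + 1) \ block n (β j), (X + C (s : R))

/-- The eighth power of the product of the OTHER pole factors, recentred at the pole `q₀`:
`E_{q₀} = ∏_{s ≤ n, s ≠ q₀} (X + (s − q₀))^8`. -/
def ER (n q₀ : ℕ) : R[X] := ∏ s ∈ (range (n + 1)).erase q₀, (X + C ((s : R) - q₀)) ^ 8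

end Model

/-- The constant coefficient `e₀(q₀) = ∏_{s ≤ n, s ≠ q₀} (s − q₀)^8 ∈ ℤ` of `E_{q₀}`. -/
def e0Z (n q₀ : ℕ) : ℤ := ∏ s ∈ (range (n + 1)).erase q₀, ((s : ℤ) - q₀) ^ 8

/-- The INTEGER `z_{q₀,i}`: the `i`-th coefficient of `numR(X − q₀) · truncInv E_{q₀} 8` over `ℤ`. -/
def zZ (n : ℕ) (β : ℕ → ℕ) (q₀ i : ℕ) : ℤ :=
  (taylor (-(q₀ : ℤ)) (numR ℤ n β) * truncInv (ER ℤ n q₀) 8).coeff i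

/-- The block-form numerator is compatible with ring maps (it is defined through ℕ-casts). -/
theorem numR_map {R S : Type*} [CommRing R] [CommRing S] (φ : R →+* S) (n : ℕ) (β : ℕ → ℕ) :
    (numR R n β).map φ = numR S n β := by
  simp only [numR, Polynomial.map_mul, Polynomial.map_add, Polynomial.map_prod, map_C, map_X]
  simp only [map_natCast, map_ofNat]

/-- `E_{q₀}` is compatible with ring maps. -/
theorem ER_map {R S : Type*} [CommRing R] [CommRing S] (φ : R →+* S) (n q₀ : ℕ) :
    (ER R n q₀).map φ = ER S n q₀ := by
  simp only [ER, Polynomial.map_prod, Polynomial.map_pow, Polynomial.map_add, map_C, map_X]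
  simp only [map_sub, map_natCast]

/-- The constant coefficient of `E_{q₀}` over `ℤ` is `e₀(q₀)`. -/
theorem ER_coeff_zero (n q₀ : ℕ) : (ER ℤ n q₀).coeff 0 = e0Z n q₀ := by
  rw [ER, e0Z, coeff_zero_prod]
  refine prod_congr rfl fun s _ => ?_
  rw [coeff_zero_eq_eval_zero, eval_pow, eval_add, eval_X, eval_C, zero_add]

/-- `e₀(q₀) ≠ 0`. -/
theorem e0Z_ne_zero (n q₀ : ℕ) : e0Z n q₀ ≠ 0 := by
  rw [e0Z]
  refine prod_ne_zero_iff.2 fun s hs => pow_ne_zero _ ?_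
  have : s ≠ q₀ := (mem_erase.1 hs).1
  omega

/-- No prime `p > n` divides `e₀(q₀)` (all factors are `s − q₀` with `0 < |s − q₀| ≤ n`). -/
theorem not_dvd_e0Z {p : ℕ} (hp : p.Prime) {n : ℕ} (hn : n < p) (q₀ : ℕ) (hq₀ : q₀ ≤ n) :
    ¬ (p : ℤ) ∣ e0Z n q₀ := by
  have hpZ : Prime (p : ℤ) := Nat.prime_iff_prime_int.1 hp
  rw [e0Z]
  intro h
  obtain ⟨s, hs, hdvd⟩ := (hpZ.dvd_finsetProd_iff _).1 h
  have hsq : s ≠ q₀ ∧ s < n + 1 := by simpa [mem_erase, mem_range] using hs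
  have h1 : (p : ℤ) ∣ (s : ℤ) - q₀ := hpZ.dvd_of_dvd_pow hdvd
  have h2 : ((s : ℤ) - q₀) = 0 := by
    refine Int.eq_zero_of_dvd_of_natAbs_lt_natAbs h1 ?_
    simp only [Int.natAbs_natCast]
    omega
  omega

/-! ### Block form of the numerator -/

/-- `DualSeriesNine.numPoly b` is the ℚ-image of the integer block-form numerator. -/
theorem numPoly_eq_numR (b : ℕ → ℤ) (hb : InBox b) (hhalf : ∀ j ∈ range 9, 2 * b (j + 1) ≤ b 0 + 1) :
    numPoly b = numR ℚ (b 0).toNat (fun j => (b (j + 1)).toNat) := by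
  obtain ⟨h0, hj⟩ := hb
  have hb0 : (b 0 : ℚ) = ((b 0).toNat : ℚ) := by exact_mod_cast (Int.toNat_of_nonneg h0).symm
  unfold numPoly numR
  rw [hb0]
  congr 1
  refine prod_congr rfl fun j hj' => ?_
  have hβ0 := (hj j hj').1
  have hβ1 := (hj j hj').2
  have hh := hhalf j hj'
  have hcast : ((b 0 - b (j + 1) + 1 : ℤ) : ℚ) = (((b 0).toNat + 1 - (b (j + 1)).toNat : ℕ) : ℚ) := by
    have e1 : (b 0 : ℤ) = ((b 0).toNat : ℤ) := (Int.toNat_of_nonneg h0).symm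
    have e2 : (b (j + 1) : ℤ) = ((b (j + 1)).toNat : ℤ) := (Int.toNat_of_nonneg hβ0).symm
    have hle : (b (j + 1)).toNat ≤ (b 0).toNat + 1 := by omega
    have e2' : (b (j + 1) : ℚ) = ((b (j + 1)).toNat : ℚ) := by exact_mod_cast e2
    rw [Nat.cast_sub hle]
    push_cast
    rw [hb0, e2']
    ring
  rw [hcast]
  exact pochPoly_pair_eq_prod_compl _ _ (by omega)

/-! ### From partial-fraction data to a polynomial identity -/

/-- The partial-fraction expansion with cleared denominators, as a polynomial in `y = t + 1`:
`L = Σ_{q ≤ n} Σ_{o<8} c_{o,q} (X + q)^{7−o} ∏_{s ≠ q} (X + s)^8`. -/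
def Lpoly (n : ℕ) (c : ℕ → ℕ → ℚ) : ℚ[X] :=
  ∑ q ∈ range (n + 1), ∑ o ∈ range 8,
    C (c o q) * (X + C (q : ℚ)) ^ (7 - o) * ∏ s ∈ (range (n + 1)).erase q, (X + C (s : ℚ)) ^ 8

/-- Evaluation of `L` away from the poles: `L(y) = (∏_{s ≤ n} (y+s))^8 · Σ_{q,o} c_{o,q}/(y+q)^{o+1}`. -/
theorem Lpoly_eval (n : ℕ) (c : ℕ → ℕ → ℚ) (y : ℚ) (hy : ∀ s ∈ range (n + 1), y + s ≠ 0) :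
    (Lpoly n c).eval y =
      (∏ s ∈ range (n + 1), (y + s)) ^ 8 *
        ∑ q ∈ range (n + 1), ∑ o ∈ range 8, c o q / (y + q) ^ (o + 1) := by
  rw [Lpoly, eval_finsetSum, mul_sum]
  refine sum_congr rfl fun q hq => ?_
  rw [eval_finsetSum, mul_sum]
  refine sum_congr rfl fun o ho => ?_
  have hyq : y + q ≠ 0 := hy q hq
  have hprod : (∏ s ∈ range (n + 1), (y + s)) ^ 8 =
      (y + q) ^ (7 - o) * (y + q) ^ (o + 1) * ∏ s ∈ (range (n + 1)).erase q, (y + (s : ℚ)) ^ 8 := by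
    rw [← mul_prod_erase (range (n + 1)) (fun s => y + (s : ℚ)) hq, mul_pow, ← prod_pow, ← pow_add]
    congr 2
    have := mem_range.1 ho
    omega
  simp only [eval_mul, eval_C, eval_pow, eval_add, eval_X, eval_prod]
  rw [hprod]
  field_simp

/-- **Polynomial identity.** Partial-fraction data of `R_b` satisfy `L = numPoly b` in `ℚ[X]`. -/
theorem Lpoly_eq_numPoly (b : ℕ → ℤ) {c : ℕ → ℕ → ℚ} (hc : IsPFData9 b c) :
    Lpoly (b 0).toNat c = numPoly b := by
  set n := (b 0).toNat with hn
  apply Polynomial.eq_of_infinite_eval_eq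
  have hsub : (fun m : ℕ => ((m : ℚ) + 1)) '' Set.univ ⊆
      {x : ℚ | (Lpoly n c).eval x = (numPoly b).eval x} := by
    rintro x ⟨m, -, rfl⟩
    have hpole : ∀ q, q ≤ n → (m : ℚ) + q + 1 ≠ 0 := fun q _ => by positivity
    have h := hc (m : ℚ) hpole
    have hy : ∀ s ∈ range (n + 1), (m : ℚ) + 1 + s ≠ 0 := fun s _ => by positivity
    have hD : (∏ s ∈ range (n + 1), ((m : ℚ) + 1 + s)) ≠ 0 := prod_ne_zero_iff.2 hy
    show (Lpoly n c).eval ((m : ℚ) + 1) = (numPoly b).eval ((m : ℚ) + 1)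
    rw [Lpoly_eval n c _ hy]
    have hnum : ((numPoly b).comp (X + C 1)).eval (m : ℚ) = (numPoly b).eval ((m : ℚ) + 1) := by
      rw [eval_comp, eval_add, eval_X, eval_C]
    have hpoch : poch ((m : ℚ) + 1) (n + 1) = ∏ s ∈ range (n + 1), ((m : ℚ) + 1 + s) := rfl
    rw [pfEval, hnum, hpoch] at h
    have h' : ∑ q ∈ range (n + 1), ∑ o ∈ range 8, c o q / ((m : ℚ) + 1 + q) ^ (o + 1) =
        (numPoly b).eval ((m : ℚ) + 1) / (∏ s ∈ range (n + 1), ((m : ℚ) + 1 + s)) ^ 8 := by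
      rw [← h]
      refine sum_congr rfl fun q _ => sum_congr rfl fun o _ => ?_
      ring
    rw [h', mul_div_cancel₀ _ (pow_ne_zero 8 hD)]
  refine Set.Infinite.mono hsub (Set.infinite_univ.image fun x _ y _ hxy => ?_)
  exact_mod_cast (add_left_inj (1 : ℚ)).1 hxy

/-! ### Taylor expansion at a pole -/

/-- At the pole `y = −q₀`: `numPoly(X − q₀) ≡ (Σ_{o<8} c_{o,q₀} X^{7−o}) · E_{q₀} (mod X^8)`. -/
theorem taylor_numPoly_congr (b : ℕ → ℤ) {c : ℕ → ℕ → ℚ} (hc : IsPFData9 b c) {q₀ : ℕ}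
    (hq₀ : q₀ ≤ (b 0).toNat) :
    X ^ 8 ∣ taylor (-(q₀ : ℚ)) (numPoly b) -
      (∑ o ∈ range 8, C (c o q₀) * X ^ (7 - o)) * ER ℚ (b 0).toNat q₀ := by
  set n := (b 0).toNat with hn
  have hmem : q₀ ∈ range (n + 1) := mem_range.2 (by omega)
  rw [← Lpoly_eq_numPoly b hc, Lpoly, map_sum, ← add_sum_erase _ _ hmem]
  -- the `q = q₀` term is exactly the subtracted expression
  have hmain : taylor (-(q₀ : ℚ)) (∑ o ∈ range 8, C (c o q₀) * (X + C (q₀ : ℚ)) ^ (7 - o) *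
        ∏ s ∈ (range (n + 1)).erase q₀, (X + C (s : ℚ)) ^ 8) =
      (∑ o ∈ range 8, C (c o q₀) * X ^ (7 - o)) * ER ℚ n q₀ := by
    rw [map_sum, sum_mul]
    refine sum_congr rfl fun o _ => ?_
    rw [taylor_mul, taylor_mul, taylor_pow, taylor_C, taylor_X_add_C, add_neg_cancel, C_0, add_zero,
      taylor_prod']
    congr 1
    rw [ER]
    refine prod_congr rfl fun s _ => ?_
    rw [taylor_pow, taylor_X_add_C, sub_eq_add_neg]
  rw [hmain, add_sub_cancel_left]
  refine dvd_sum fun q hq => ?_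
  have hq' : q ≠ q₀ := (mem_erase.1 hq).1
  rw [map_sum]
  refine dvd_sum fun o _ => ?_
  rw [taylor_mul, taylor_prod']
  refine Dvd.dvd.mul_left ?_ _
  have hmem' : q₀ ∈ (range (n + 1)).erase q := mem_erase.2 ⟨fun h => hq' h.symm, hmem⟩
  have hfac : taylor (-(q₀ : ℚ)) ((X + C (q₀ : ℚ)) ^ 8) = X ^ 8 := by
    rw [taylor_pow, taylor_X_add_C, add_neg_cancel, C_0, add_zero]
  rw [← hfac]
  exact Finset.dvd_prod_of_mem (fun s : ℕ => taylor (-(q₀ : ℚ)) ((X + C (s : ℚ)) ^ 8)) hmem'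

/-- **The partial-fraction coefficients are Taylor coefficients with integer numerators**:
`e₀(q₀)^8 · c_{o,q₀} = z_{q₀, 7−o}` for `q₀ ≤ n`, `o < 8`. -/
theorem pf_coeff_eq (b : ℕ → ℤ) (hb : InBox b) (hhalf : ∀ j ∈ range 9, 2 * b (j + 1) ≤ b 0 + 1)
    {c : ℕ → ℕ → ℚ} (hc : IsPFData9 b c) {q₀ : ℕ} (hq₀ : q₀ ≤ (b 0).toNat) {o : ℕ} (ho : o < 8) :
    ((e0Z (b 0).toNat q₀ : ℤ) : ℚ) ^ 8 * c o q₀ =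
      (zZ (b 0).toNat (fun j => (b (j + 1)).toNat) q₀ (7 - o) : ℚ) := by
  set n := (b 0).toNat with hn
  set β : ℕ → ℕ := fun j => (b (j + 1)).toNat with hβ
  set S : ℚ[X] := ∑ o ∈ range 8, C (c o q₀) * X ^ (7 - o) with hS
  set J : ℚ[X] := truncInv (ER ℚ n q₀) 8 with hJ
  have h1 := taylor_numPoly_congr b hc hq₀
  have h2 := truncInv_spec (ER ℚ n q₀) 8
  have he0 : (ER ℚ n q₀).coeff 0 = (e0Z n q₀ : ℚ) := by
    rw [← ER_map (Int.castRingHom ℚ), coeff_map, ER_coeff_zero]; simp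
  -- X^8 ∣ taylor(numPoly)·J − S·C(e₀^8)
  have h3 : X ^ 8 ∣ taylor (-(q₀ : ℚ)) (numPoly b) * J - S * C ((e0Z n q₀ : ℚ) ^ 8) := by
    have h1' := h1.mul_right J
    have h2' := h2.mul_left S
    rw [he0] at h2'
    have : taylor (-(q₀ : ℚ)) (numPoly b) * J - S * C ((e0Z n q₀ : ℚ) ^ 8) =
        (taylor (-(q₀ : ℚ)) (numPoly b) - S * ER ℚ n q₀) * J + S * (ER ℚ n q₀ * J - C ((e0Z n q₀ : ℚ) ^ 8)) := by
      ring
    rw [this]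
    exact dvd_add h1' h2'
  have h4 := coeff_eq_of_X_pow_dvd_sub h3 (show 7 - o < 8 by omega)
  -- left side: the integer polynomial
  have hL : taylor (-(q₀ : ℚ)) (numPoly b) * J =
      (taylor (-(q₀ : ℤ)) (numR ℤ n β) * truncInv (ER ℤ n q₀) 8).map (Int.castRingHom ℚ) := by
    rw [Polynomial.map_mul, BigPrime.map_taylor, numR_map, truncInv_map, ER_map, numPoly_eq_numR b hb hhalf]
    simp [hJ, hn, hβ]
  -- right side: the single surviving coefficient
  have hR : (S * C ((e0Z n q₀ : ℚ) ^ 8)).coeff (7 - o) = ((e0Z n q₀ : ℤ) : ℚ) ^ 8 * c o q₀ := by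
    rw [hS, sum_mul, finsetSum_coeff, sum_eq_single o]
    · simp only [coeff_mul_C, coeff_C_mul, coeff_X_pow, if_true]; ring
    · intro o' ho' hne
      have hne' : 7 - o ≠ 7 - o' := by have := mem_range.1 ho'; omega
      simp only [coeff_mul_C, coeff_C_mul, coeff_X_pow, if_neg hne']; ring
    · intro h; exact absurd (mem_range.2 ho) h
  rw [hL, coeff_map, hR] at h4
  rw [← h4, zZ]
  simp

end Summit.KontsevichZagierPeriods.Zeta5Search.BigPrimeNine

end
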